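import Summits.ValiantsHypothesis.ValiantsHypothesis.Theorems.DefinabilityGapAffineRung
import Summits.ValiantsHypothesis.ValiantsHypothesis.Theorems.DefinabilityGapSupportRung
import HarnessLib

/-!
# DefinabilityGap — the SYMMETRY LAYER of the planted KI-permanent map (unconditional, kernel)

Route `route-ValiantsHypothesis-DefinabilityGap` (decomp-valiant cycle 1, lens 5: hardness–randomness / PIT axis),
supporting the bet item `KIAnnihilatorCHDefinable` (stmt-ValiantsHypothesis-23444, K2ch) and the hitting residual
`KIPlantedHitting` (stmt-ValiantsHypothesis-23547, K1).

The generator `G_m : ℂ^{q²} → ℂ^{q³}`, `c ↦ per_m(y|S_c)` (`kiPer`), is EQUIVARIANT under the affine group of the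
value line acting on curves, `c ↦ u·c + t` (`u ∈ 𝔽_q`, `t ∈ 𝔽_q³`), through the cell maps `(i, j) ↦ (i, u·j + p_t(i))`
(`p_t` the quadratic with coefficient vector `t`; `(i, p_t(i)) = quadDesign m t i`):

* `quadDesign_fst`, `quadDesign_snd_add`, `quadDesign_snd_mul` — the design's ordinate is ℤ/q-linear in `c`;
* `kiPer_add`, `kiPer_mul`, `kiPer_affine` — `G_m(u·c + t) = rename (cell map) (G_m(c))`;
* `bind₁_kiPer_rename_add` — composing with `G_m` intertwines the translation of output variables with the cell map, so
  the ANNIHILATOR IDEAL `I(G_m)` is translation-stable (`kiPer_annihilates_rename_add`), and (`exists_invariant_annihilator`)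
  every nonzero annihilator `A` yields a nonzero TRANSLATION-INVARIANT annihilator `∏_t A(z_{·+t})` of total degree
  `≤ q³ · deg A` (still p-bounded: `q ≤ 2(m²+1)`): without loss of generality the sought annihilator of K2-type items is a
  polynomial in translation-ORBIT sums — the search space of the bet K2ch, and the block-diagonalisation used by the
  route's degree-2 instrument at `m = 3` (route folder `v4/instrument-deg2-m3.md`);
* `kiPer_hits_vars_of_indep`, `kiPer_hits_size_of_indep` — the K1 size ladder in GIRTH form: if every `g` block
  permanents of `G_m` are algebraically independent then every nonzero `D` reading `≤ g` variables (in particular every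
  `D` of circuit size `≤ (g-1)/2`) is hit; with `g = (m²+1)/2` this is the landed support/size rung
  (`kiPer_algebraicIndependent`), with `g = 2q+1` it is K1's first integer rung `b = 1`, and `g ≤ m²·q + 1` always
  (transcendence degree) — the ceiling `b = 2` of this road.
0 sorry; no new definitions.
-/

noncomputable section

open MvPolynomial
open Literature.Computability.AlgebraicComplexity Literature.Computability.MetaComplexity
open Summit.ValiantsHypothesis.ValiantsHypothesis.Theorems.DefinabilityGapAffineRung

namespace Summit.ValiantsHypothesis.ValiantsHypothesis.Theorems.DefinabilityGapSymmetry

variable {m : ℕ}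

/-! ### The design's ordinate is linear in the curve -/

/-- Unfolding the quadratic-curve design: position `k` of curve `c` is the cell `(k, E⁻¹(p_{E∘c}(E k)))`,
`E : Fin q ≃+* ZMod q`. [this file] -/
theorem quadDesign_apply' (m : ℕ) (c : Fin 3 → Fin (qOf m)) (k : Fin (qOf m)) :
    haveI : NeZero (qOf m) := ⟨(qOf_spec m).2.ne_zero⟩
    quadDesign m c k = (k, (ZMod.finEquiv (qOf m)).symm
      ((Polynomial.ofFn 3 (fun i => ZMod.finEquiv (qOf m) (c i))).eval (ZMod.finEquiv (qOf m) k))) := by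
  haveI : NeZero (qOf m) := ⟨(qOf_spec m).2.ne_zero⟩
  refine Prod.ext ?_ rfl
  exact (ZMod.finEquiv (qOf m)).toEquiv.symm_apply_apply k

/-- The abscissa of position `k` is `k` itself. [this file] -/
@[simp] theorem quadDesign_fst (m : ℕ) (c : Fin 3 → Fin (qOf m)) (k : Fin (qOf m)) :
    (quadDesign m c k).1 = k := by
  rw [quadDesign_apply']

/-- **Ordinates are additive in the curve**: `S_{c+t}(k) = S_c(k) + S_t(k)` (second coordinates, in `ℤ/q`). [this file] -/
theorem quadDesign_snd_add (m : ℕ) (c t : Fin 3 → Fin (qOf m)) (k : Fin (qOf m)) :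
    (quadDesign m (c + t) k).2 = (quadDesign m c k).2 + (quadDesign m t k).2 := by
  haveI : NeZero (qOf m) := ⟨(qOf_spec m).2.ne_zero⟩
  rw [quadDesign_apply', quadDesign_apply', quadDesign_apply']
  dsimp only
  rw [← map_add, ← Polynomial.eval_add, ← map_add]
  congr 3
  funext i
  exact map_add (ZMod.finEquiv (qOf m)) (c i) (t i)

/-- **Ordinates are homogeneous in the curve**: `S_{u·c}(k) = u · S_c(k)`. [this file] -/
theorem quadDesign_snd_mul (m : ℕ) (u : Fin (qOf m)) (c : Fin 3 → Fin (qOf m)) (k : Fin (qOf m)) :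
    (quadDesign m (fun i => u * c i) k).2 = u * (quadDesign m c k).2 := by
  haveI : NeZero (qOf m) := ⟨(qOf_spec m).2.ne_zero⟩
  rw [quadDesign_apply', quadDesign_apply']
  dsimp only
  set E := ZMod.finEquiv (qOf m) with hE
  have hfun : (fun i => E (u * c i)) = E u • (fun i => E (c i)) := by
    funext i
    rw [Pi.smul_apply, smul_eq_mul, map_mul]
  rw [hfun, map_smul, Polynomial.eval_smul, smul_eq_mul, map_mul]
  congr 1
  exact E.toEquiv.symm_apply_apply u

/-! ### Equivariance of the generator -/

/-- **Translation equivariance**: `G_m(c + t) = G_m(c)` with every seed variable `y_{(i,j)}` renamed to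
`y_{(i, j + p_t(i))}`. [this file] -/
theorem kiPer_add (m : ℕ) (c t : Fin 3 → Fin (qOf m)) :
    kiPer m (c + t) =
      rename (fun p : Fin (qOf m) × Fin (qOf m) => (p.1, p.2 + (quadDesign m t p.1).2)) (kiPer m c) := by
  have h : (⇑(quadDesign m (c + t)) : Fin (qOf m) → Fin (qOf m) × Fin (qOf m)) =
      (fun p : Fin (qOf m) × Fin (qOf m) => (p.1, p.2 + (quadDesign m t p.1).2)) ∘ ⇑(quadDesign m c) := by
    funext k
    refine Prod.ext ?_ ?_
    · simp
    · simp only [Function.comp_apply, quadDesign_fst]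
      exact quadDesign_snd_add m c t k
  rw [kiPer, kiGenerator_apply, kiGenerator_apply, rename_rename, h]

/-- **Dilation equivariance**: `G_m(u·c) = G_m(c)` with `y_{(i,j)} ↦ y_{(i, u·j)}` (for `u = 0` both sides are the
permanent on the axis `j = 0`). [this file] -/
theorem kiPer_mul (m : ℕ) (u : Fin (qOf m)) (c : Fin 3 → Fin (qOf m)) :
    kiPer m (fun i => u * c i) =
      rename (fun p : Fin (qOf m) × Fin (qOf m) => (p.1, u * p.2)) (kiPer m c) := by
  have h : (⇑(quadDesign m (fun i => u * c i)) : Fin (qOf m) → Fin (qOf m) × Fin (qOf m)) =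
      (fun p : Fin (qOf m) × Fin (qOf m) => (p.1, u * p.2)) ∘ ⇑(quadDesign m c) := by
    funext k
    refine Prod.ext ?_ ?_
    · simp
    · simp only [Function.comp_apply]
      exact quadDesign_snd_mul m u c k
  rw [kiPer, kiGenerator_apply, kiGenerator_apply, rename_rename, h]

/-- **Affine equivariance**: `G_m(u·c + t) = G_m(c)` with `y_{(i,j)} ↦ y_{(i, u·j + p_t(i))}`. [this file] -/
theorem kiPer_affine (m : ℕ) (u : Fin (qOf m)) (c t : Fin 3 → Fin (qOf m)) :
    kiPer m ((fun i => u * c i) + t) =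
      rename (fun p : Fin (qOf m) × Fin (qOf m) => (p.1, u * p.2 + (quadDesign m t p.1).2)) (kiPer m c) := by
  rw [kiPer_add, kiPer_mul, rename_rename]
  rfl

/-! ### The annihilator ideal is translation-stable; WLOG invariant annihilators -/

/-- **Intertwining**: substituting `G_m` into `A(z_{·+t})` is the cell-renaming of `A ∘ G_m`. [this file] -/
theorem bind₁_kiPer_rename_add (m : ℕ) (t : Fin 3 → Fin (qOf m))
    (A : MvPolynomial (Fin 3 → Fin (qOf m)) ℂ) :
    bind₁ (kiPer m) (rename (fun c => c + t) A) =
      rename (fun p : Fin (qOf m) × Fin (qOf m) => (p.1, p.2 + (quadDesign m t p.1).2))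
        (bind₁ (kiPer m) A) := by
  have h : (kiPer m ∘ fun c => c + t) =
      fun c => rename (fun p : Fin (qOf m) × Fin (qOf m) => (p.1, p.2 + (quadDesign m t p.1).2)) (kiPer m c) :=
    funext fun c => kiPer_add m c t
  rw [bind₁_rename, rename_bind₁, h]

/-- **Annihilators are translation-stable**: if `A ∘ G_m = 0` then `A(z_{·+t}) ∘ G_m = 0`. [this file] -/
theorem kiPer_annihilates_rename_add (m : ℕ) (t : Fin 3 → Fin (qOf m))
    {A : MvPolynomial (Fin 3 → Fin (qOf m)) ℂ} (hA : bind₁ (kiPer m) A = 0) :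
    bind₁ (kiPer m) (rename (fun c => c + t) A) = 0 := by
  rw [bind₁_kiPer_rename_add, hA, map_zero]

/-- Translation of the output variables is injective on polynomials. [folklore] -/
theorem rename_add_injective (m : ℕ) (t : Fin 3 → Fin (qOf m)) :
    Function.Injective
      (rename (fun c : Fin 3 → Fin (qOf m) => c + t) :
        MvPolynomial (Fin 3 → Fin (qOf m)) ℂ → MvPolynomial (Fin 3 → Fin (qOf m)) ℂ) := by
  refine rename_injective _ ?_
  intro c c' h
  funext i
  exact add_right_cancel (congrFun h i)

/-- **The norm product** `N(A) = ∏_{t ∈ 𝔽_q³} A(z_{·+t})` of a nonzero annihilator is a nonzero, translation-INVARIANT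
annihilator of total degree `≤ q³ · deg A`. [this file] -/
theorem exists_invariant_annihilator (m : ℕ) {A : MvPolynomial (Fin 3 → Fin (qOf m)) ℂ} (hA0 : A ≠ 0)
    (hA : bind₁ (kiPer m) A = 0) :
    ∃ N : MvPolynomial (Fin 3 → Fin (qOf m)) ℂ, N ≠ 0 ∧ bind₁ (kiPer m) N = 0 ∧
      (∀ s : Fin 3 → Fin (qOf m), rename (fun c => c + s) N = N) ∧
      N.totalDegree ≤ (qOf m) ^ 3 * A.totalDegree := by
  classical
  haveI : NeZero (qOf m) := ⟨(qOf_spec m).2.ne_zero⟩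
  refine ⟨∏ t : Fin 3 → Fin (qOf m), rename (fun c => c + t) A, ?_, ?_, ?_, ?_⟩
  · rw [Finset.prod_ne_zero_iff]
    intro t _ h
    exact hA0 (rename_add_injective m t (by rw [h, map_zero]))
  · rw [map_prod]
    exact Finset.prod_eq_zero (Finset.mem_univ 0) (kiPer_annihilates_rename_add m 0 hA)
  · intro s
    rw [map_prod]
    simp_rw [rename_rename]
    have hcomp : ∀ t : Fin 3 → Fin (qOf m),
        ((fun c : Fin 3 → Fin (qOf m) => c + s) ∘ fun c => c + t) = fun c => c + (t + s) := by
      intro t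
      funext c
      simp only [Function.comp_apply, add_assoc]
    simp_rw [hcomp]
    exact Fintype.prod_equiv (Equiv.addRight s) _ _ (fun t => rfl)
  · refine (totalDegree_finsetProd _ _).trans ?_
    refine (Finset.sum_le_sum fun t _ => totalDegree_rename_le _ _).trans ?_
    rw [Finset.sum_const, smul_eq_mul, Finset.card_univ, Fintype.card_fun, Fintype.card_fin,
      Fintype.card_fin]

/-! ### The K1 size ladder in girth form -/

/-- **Girth ⟹ hitting**: if every `g` block permanents of `G_m` are algebraically independent, then every nonzero `D`
reading at most `g` of the `q³` variables is hit. [folklore] -/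
theorem kiPer_hits_vars_of_indep (m g : ℕ)
    (hind : ∀ T : Finset (Fin 3 → Fin (qOf m)), T.card ≤ g →
      AlgebraicIndependent ℂ (fun c : T => kiPer m c))
    {D : MvPolynomial (Fin 3 → Fin (qOf m)) ℂ} (hD : D ≠ 0) (hvars : D.vars.card ≤ g) :
    bind₁ (kiPer m) D ≠ 0 := by
  classical
  obtain ⟨D', hD'⟩ := exists_rename_eq_of_vars_subset_range D ((↑) : D.vars → Fin 3 → Fin (qOf m))
    Subtype.val_injective (by simp)
  have hD'0 : D' ≠ 0 := by
    rintro rfl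
    exact hD (by rw [← hD', map_zero])
  rw [← hD', bind₁_rename]
  exact fun h => hD'0 ((hind D.vars hvars).eq_zero_of_aeval_eq_zero D' h)

/-- **Girth ⟹ the size rung**: under the same hypothesis every nonzero `D` of circuit complexity `L(D)` with
`2·L(D) + 1 ≤ g` is hit (a size-`L` circuit reads `≤ 2L+1` variables). With `g = 2·q(m) + 1` this is K1's rung `b = 1`
(`complexity D ≤ q(m)`), with no degree hypothesis. [folklore] -/
theorem kiPer_hits_size_of_indep (m g : ℕ)
    (hind : ∀ T : Finset (Fin 3 → Fin (qOf m)), T.card ≤ g →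
      AlgebraicIndependent ℂ (fun c : T => kiPer m c))
    {D : MvPolynomial (Fin 3 → Fin (qOf m)) ℂ} (hD : D ≠ 0) (hsize : 2 * complexity D + 1 ≤ g) :
    bind₁ (kiPer m) D ≠ 0 :=
  kiPer_hits_vars_of_indep m g hind hD
    ((ArithCircuit.card_vars_le_two_mul_complexity_add_one D).trans hsize)

end Summit.ValiantsHypothesis.ValiantsHypothesis.Theorems.DefinabilityGapSymmetry

end
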